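import Literature.Probability.RandomPlanarGeometry.SAWLoopErasureMemoryTwo
import HarnessLib

/-!
# Memory-2 loops with a taboo on the penultimate site — Hara–Slade–Sokal (3.16)–(3.18) at coefficient level

Hara, Slade and Sokal [HSS93, §3.3 p. 19] reduce the loop generating function `C̃^{A;e}₂(0,0;β)` of the
memory-2 (`τ = 2̃`) loop erasure — closed non-backtracking loops at `0` avoiding the finite set `A` whose
next-to-last site is not `e` — to the two memory-2 two-point functions `C^A₂(0,0;β)` and `C^A₂(0,e;β)`:
as printed,

* (3.16) `C̃^{A;e}₂(0,0;β) = C^A₂(0,0;β) − Σ_{ω: 0 → 0, ω ∩ A = ∅, ω(|ω|−1) = e} β^{|ω|}`,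
* (3.17) `Σ_{ω: 0 → 0, ω ∩ A = ∅, ω(|ω|−1) = e} β^{|ω|} = (β/(1−β²))·[C^A₂(0,e;β) − β·C^A₂(0,0;β)]`,
* (3.18) `C̃^{A;e}₂(0,0;β) = (1/(1−β²))·[C^A₂(0,0;β) − β·C^A₂(0,e;β)]`,

"and hence the bound (2.39) can be computed once we know the values of `C^A₂(0,0;1/(2d−1))` and
`C^A₂(0,e;1/(2d−1))`."

This module proves the COEFFICIENT-LEVEL content of (3.16)–(3.18) for the finite sets of the tree's memory-2 loop
erasure (`SAWLoopErasureMemoryTwo`: `closedNbwPen A s σ` are the loops counted by `C̃^{A;e_s}₂(0,0;·)`):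
with `a_σ = #nbwAvoidTo A 0 σ` (coefficients of `C^A₂(0,0;·)`), `q_σ = #nbwAvoidTo A e_s σ` (coefficients of
`C^A₂(0,e_s;·)`), `p̃_σ = #closedNbwPen A s σ` and `ℓ_σ = #closedNbwLast A s σ` (the loops whose next-to-last
site IS `e_s`, i.e. whose last step is `−s`), for `0 ∉ A`, `e_s ∉ A`:

* (3.16) `p̃_σ + ℓ_σ = a_σ` (`card_closedNbwPen_add_card_closedNbwLast`);
* the bijections behind (3.17): `ℓ_{σ+2} + p̃_σ = q_{σ+1}` (`card_closedNbwLast_add_two_add`) — a loop with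
  next-to-last site `e_s` is a walk `0 → e_s` whose last step is not `+s`, followed by the step `−s`, and the walks
  `0 → e_s` whose last step IS `+s` are the penalised loops two steps shorter followed by `+s`;
* hence the linear recurrence `p̃_{σ+2} + q_{σ+1} = a_{σ+2} + p̃_σ` (`card_closedNbwPen_add_two_add`), and for the
  truncated generating functions `P_K = Σ_{σ≤K} p̃_σ βᵠ`, `Q_K`, `A_K` the exact identity
  `P_{K+2} + β·Q_{K+1} = A_{K+2} + β²·P_K` (`sum_closedNbwPen_add_two_eq`, (3.18) multiplied out and truncated),
  the inequality `(1 − β²)·P_{K+2} ≤ A_{K+2} − β·Q_{K+1}` for `β ≥ 0`, and the uniform bound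
  `P_K ≤ (A⁺ − β·Q_{K₀})/(1 − β²)` for every `K`, given `A_K ≤ A⁺` for all `K` and `0 ≤ β < 1`
  (`sum_closedNbwPen_le_div`) — the form in which (3.18) feeds a `W` of `hss_memoryTwo_div_le_connectiveConstant`.

No generating function is summed to infinity here; (3.18) itself (an identity of power series) is the `K → ∞`
limit of `sum_closedNbwPen_add_two_eq`.
-/

noncomputable section

namespace Literature.Probability.RandomPlanarGeometry.SAW.Zd.LoopErasure

open Finset
open scoped BigOperators
open Literature.Probability.LatticeModels Literature.Probability.LatticeModels.SRW
open Literature.Probability.Percolation (IsNBW srev srev_srev)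

variable {d : ℕ}

/-! ### Appending a step: plumbing -/

/-- `(ω·a)_i = ω_i` below the end. [cite: MadrasSlade1993, §1.2 (p. 10) (step words; lane plumbing)] -/
theorem stepSeq_snoc_apply_lt {n : ℕ} (ω : StepSeq d n) (a : Dir d) {i : ℕ} (hi : i < n) (h : i < n + 1) :
    (Fin.snoc ω a : StepSeq d (n + 1)) ⟨i, h⟩ = ω ⟨i, hi⟩ := by
  have e : (⟨i, h⟩ : Fin (n + 1)) = Fin.castSucc ⟨i, hi⟩ := rfl
  rw [e, Fin.snoc_castSucc]

/-- `(ω·a)_n = a`. [cite: MadrasSlade1993, §1.2 (p. 10) (step words; lane plumbing)] -/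
theorem stepSeq_snoc_apply_eq {n : ℕ} (ω : StepSeq d n) (a : Dir d) {i : ℕ} (hi : i = n) (h : i < n + 1) :
    (Fin.snoc ω a : StepSeq d (n + 1)) ⟨i, h⟩ = a := by
  subst hi
  have e : (⟨i, h⟩ : Fin (i + 1)) = Fin.last i := rfl
  rw [e, Fin.snoc_last]

/-- Positions of `ω·a` up to time `n` are those of `ω`. [cite: MadrasSlade1993, §1.2 (p. 10) (step words; lane plumbing)] -/
theorem pos_snoc_of_le {n : ℕ} (ω : StepSeq d n) (a : Dir d) {t : ℕ} (ht : t ≤ n) :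
    pos (Fin.snoc ω a : StepSeq d (n + 1)) t = pos ω t := by
  rw [pos_eq_sum_range _ (ht.trans (Nat.le_succ n)), pos_eq_sum_range _ ht]
  refine Finset.sum_congr rfl fun i hi => ?_
  have hi' : i < n := lt_of_lt_of_le (Finset.mem_range.1 hi) ht
  rw [dif_pos (Nat.lt_succ_of_lt hi'), dif_pos hi', stepSeq_snoc_apply_lt ω a hi']

/-- The final position of `ω·a` is `ω(n) + e_a`. [cite: MadrasSlade1993, §1.2 (p. 10) (step words; lane plumbing)] -/
theorem pos_snoc_succ {n : ℕ} (ω : StepSeq d n) (a : Dir d) :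
    pos (Fin.snoc ω a : StepSeq d (n + 1)) (n + 1) = endpoint ω + stepVec a := by
  rw [pos_eq_endpoint, endpoint_snoc]

/-- `e_{−s} = −e_s`. [cite: MadrasSlade1993, §1.2 (p. 10) (step words; lane plumbing)] -/
theorem stepVec_srev (s : Dir d) : stepVec (srev s) = -stepVec s := stepVec_neg s

/-- `ω·a` is non-backtracking iff `ω` is and `a` does not reverse the last step of `ω` (no condition for `n = 0`).
[cite: MadrasSlade1993, §1.2 (memory 2 rules out immediate reversals; lane plumbing)] -/
theorem isNBW_snoc_iff {n : ℕ} (ω : StepSeq d n) (a : Dir d) :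
    IsNBW (Fin.snoc ω a : StepSeq d (n + 1)) ↔ IsNBW ω ∧ ∀ i : Fin n, (i : ℕ) + 1 = n → ω i ≠ srev a := by
  constructor
  · intro h
    refine ⟨fun k hk => ?_, fun i hi => ?_⟩
    · have h1 := h k (by omega)
      rwa [stepSeq_snoc_apply_lt ω a hk, stepSeq_snoc_apply_lt ω a (show k < n by omega)] at h1
    · have h1 := h i (by omega)
      rw [stepSeq_snoc_apply_eq ω a hi, stepSeq_snoc_apply_lt ω a i.isLt, Fin.eta] at h1
      intro he
      exact h1 (by rw [he, srev_srev])
  · rintro ⟨h, ha⟩ k hk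
    by_cases hkn : k + 1 < n
    · rw [stepSeq_snoc_apply_lt ω a hkn, stepSeq_snoc_apply_lt ω a (show k < n by omega)]
      exact h k hkn
    · have hk1 : k + 1 = n := by omega
      rw [stepSeq_snoc_apply_eq ω a hk1, stepSeq_snoc_apply_lt ω a (show k < n by omega)]
      intro he
      exact ha ⟨k, by omega⟩ hk1 (by rw [he, srev_srev])

/-! ### Memory-2 walks to a point avoiding `A`; loops whose next-to-last site is `e_s` -/

open Classical in
/-- The `n`-step non-backtracking walks `0 → x` whose positions at times `0, …, n` avoid `A`: the coefficients of the
memory-2 two-point function `C^A₂(0,x;β)` with taboo set `A`.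
[cite: HaraSladeSokal1993, §3.2–3.3 eq. (3.16)–(3.18) p. 19 (C^A_2(0,x;β))] -/
def nbwAvoidTo (A : Finset (Site d)) (x : Site d) (n : ℕ) : Finset (StepSeq d n) :=
  (nbwAvoid A n).filter fun ω => endpoint ω = x

/-- Membership in `nbwAvoidTo`. [cite: HaraSladeSokal1993, §3.3 eq. (3.16)–(3.18) p. 19 (lane plumbing)] -/
theorem mem_nbwAvoidTo {A : Finset (Site d)} {x : Site d} {n : ℕ} {ω : StepSeq d n} :
    ω ∈ nbwAvoidTo A x n ↔ (IsNBW ω ∧ ∀ t ≤ n, pos ω t ∉ A) ∧ endpoint ω = x := by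
  classical
  rw [nbwAvoidTo, Finset.mem_filter, mem_nbwAvoid]

open Classical in
/-- The closed NBW `σ`-loops at `0` avoiding `A` whose LAST step is `−s`, i.e. whose next-to-last site is `e_s`:
the loops subtracted in (3.16). [cite: HaraSladeSokal1993, §3.3 eq. (3.16) p. 19 (ω(|ω|−1) = e)] -/
def closedNbwLast (A : Finset (Site d)) (s : Dir d) (σ : ℕ) : Finset (StepSeq d σ) :=
  (closedAvoid A σ).filter fun ω => IsNBW ω ∧ ∃ i : Fin σ, (i : ℕ) + 1 = σ ∧ ω i = srev s

/-- Membership in `closedNbwLast`. [cite: HaraSladeSokal1993, §3.3 eq. (3.16) p. 19 (lane plumbing)] -/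
theorem mem_closedNbwLast {A : Finset (Site d)} {s : Dir d} {σ : ℕ} {ω : StepSeq d σ} :
    ω ∈ closedNbwLast A s σ ↔ (endpoint ω = 0 ∧ ∀ t, t ≤ σ → pos ω t ∉ A) ∧
      (IsNBW ω ∧ ∃ i : Fin σ, (i : ℕ) + 1 = σ ∧ ω i = srev s) := by
  classical
  rw [closedNbwLast, Finset.mem_filter, mem_closedAvoid]

/-- The closed NBW loops avoiding `A` are the walks of `nbwAvoidTo A 0`; the penalised ones are those with
last step `≠ −s`. [cite: HaraSladeSokal1993, §3.3 eq. (3.16) p. 19 (lane plumbing)] -/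
theorem closedNbwPen_eq_filter (A : Finset (Site d)) (s : Dir d) (σ : ℕ) :
    closedNbwPen A s σ = (nbwAvoidTo A 0 σ).filter fun ω => ∀ i : Fin σ, (i : ℕ) + 1 = σ → ω i ≠ srev s := by
  classical
  ext ω
  rw [mem_closedNbwPen, Finset.mem_filter, mem_nbwAvoidTo]
  tauto

/-- … and the subtracted ones are those with last step `= −s`. [cite: HaraSladeSokal1993, §3.3 eq. (3.16) p. 19 (lane plumbing)] -/
theorem closedNbwLast_eq_filter (A : Finset (Site d)) (s : Dir d) (σ : ℕ) :
    closedNbwLast A s σ =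
      (nbwAvoidTo A 0 σ).filter fun ω => ¬ ∀ i : Fin σ, (i : ℕ) + 1 = σ → ω i ≠ srev s := by
  classical
  ext ω
  rw [mem_closedNbwLast, Finset.mem_filter, mem_nbwAvoidTo]
  push Not
  tauto

/-- **(3.16) at coefficient level**: `#closedNbwPen A s σ + #closedNbwLast A s σ = #nbwAvoidTo A 0 σ`
(`C̃^{A;e}₂(0,0;β) = C^A₂(0,0;β) − Σ_{ω(|ω|−1) = e} β^{|ω|}`).
[cite: HaraSladeSokal1993, §3.3 eq. (3.16) p. 19] -/
theorem card_closedNbwPen_add_card_closedNbwLast (A : Finset (Site d)) (s : Dir d) (σ : ℕ) :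
    (closedNbwPen A s σ).card + (closedNbwLast A s σ).card = (nbwAvoidTo A 0 σ).card := by
  classical
  rw [closedNbwPen_eq_filter, closedNbwLast_eq_filter]
  exact Finset.card_filter_add_card_filter_not _

/-! ### The two bijections behind (3.17) -/

/-- A loop of length `σ + 2` with next-to-last site `e_s` is a walk `0 → e_s` of length `σ + 1` whose last step is not
`+s`, followed by `−s` (for `0 ∉ A`). [cite: HaraSladeSokal1993, §3.3 eq. (3.17) p. 19 (the inclusion–exclusion "as in (3.12)")] -/
theorem closedNbwLast_add_two_eq_image {A : Finset (Site d)} (h0 : (0 : Site d) ∉ A) (s : Dir d) (σ : ℕ) :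
    closedNbwLast A s (σ + 2) =
      ((nbwAvoidTo A (stepVec s) (σ + 1)).filter fun η => η ⟨σ, by omega⟩ ≠ s).image
        fun η => (Fin.snoc η (srev s) : StepSeq d (σ + 2)) := by
  classical
  ext ω
  rw [Finset.mem_image]
  constructor
  · intro hω
    rw [mem_closedNbwLast] at hω
    obtain ⟨⟨hend, havoid⟩, hnbw, i, hi, hlast⟩ := hω
    have hi' : i = Fin.last (σ + 1) := Fin.ext (by rw [Fin.val_last]; omega)
    rw [hi'] at hlast
    have hω' : (Fin.snoc (Fin.init ω) (srev s) : StepSeq d (σ + 2)) = ω := by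
      rw [← hlast, Fin.snoc_init_self]
    refine ⟨Fin.init ω, ?_, hω'⟩
    have hnbw' := (isNBW_snoc_iff (Fin.init ω) (srev s)).1 (by rw [hω']; exact hnbw)
    rw [Finset.mem_filter, mem_nbwAvoidTo]
    refine ⟨⟨⟨hnbw'.1, fun t ht => ?_⟩, ?_⟩, ?_⟩
    · rw [← pos_snoc_of_le (Fin.init ω) (srev s) ht, hω']
      exact havoid t (by omega)
    · have h1 : pos (Fin.snoc (Fin.init ω) (srev s) : StepSeq d (σ + 2)) (σ + 1 + 1) = 0 := by
        rw [hω', pos_eq_endpoint, hend]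
      rw [pos_snoc_succ, stepVec_srev] at h1
      exact add_neg_eq_zero.1 h1
    · have h2 := hnbw'.2 ⟨σ, by omega⟩ rfl
      rwa [srev_srev] at h2
  · rintro ⟨η, hη, rfl⟩
    rw [Finset.mem_filter, mem_nbwAvoidTo] at hη
    obtain ⟨⟨⟨hnbw, havoid⟩, hend⟩, hlast⟩ := hη
    rw [mem_closedNbwLast]
    have hend' : endpoint (Fin.snoc η (srev s) : StepSeq d (σ + 2)) = 0 := by
      rw [endpoint_snoc, hend, stepVec_srev, add_neg_cancel]
    refine ⟨⟨hend', fun t ht => ?_⟩, ?_, ⟨σ + 1, by omega⟩, rfl, ?_⟩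
    · rcases Nat.lt_or_ge t (σ + 2) with hlt | hge
      · rw [pos_snoc_of_le η (srev s) (show t ≤ σ + 1 by omega)]
        exact havoid t (by omega)
      · rw [pos_of_le _ hge, hend']
        exact h0
    · exact (isNBW_snoc_iff η (srev s)).2 ⟨hnbw, fun i hi => by
        have : i = ⟨σ, by omega⟩ := Fin.ext (by simp only; omega)
        rw [this, srev_srev]; exact hlast⟩
    · exact stepSeq_snoc_apply_eq η (srev s) rfl _

/-- The walks `0 → e_s` of length `σ + 1` whose last step IS `+s` are the penalised loops of length `σ` followed by
`+s` (for `e_s ∉ A`). [cite: HaraSladeSokal1993, §3.3 eq. (3.17) p. 19 (the inclusion–exclusion "as in (3.12)")] -/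
theorem filter_nbwAvoidTo_eq_image_closedNbwPen {A : Finset (Site d)} {s : Dir d} (hs : stepVec s ∉ A) (σ : ℕ) :
    ((nbwAvoidTo A (stepVec s) (σ + 1)).filter fun η => η ⟨σ, by omega⟩ = s) =
      (closedNbwPen A s σ).image fun ζ => (Fin.snoc ζ s : StepSeq d (σ + 1)) := by
  classical
  ext η
  rw [Finset.mem_image, Finset.mem_filter, mem_nbwAvoidTo]
  constructor
  · rintro ⟨⟨⟨hnbw, havoid⟩, hend⟩, hlast⟩
    have hη' : (Fin.snoc (Fin.init η) s : StepSeq d (σ + 1)) = η := by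
      have e : η (Fin.last σ) = s := by rw [← hlast]; rfl
      rw [← e, Fin.snoc_init_self]
    refine ⟨Fin.init η, ?_, hη'⟩
    have hnbw' := (isNBW_snoc_iff (Fin.init η) s).1 (by rw [hη']; exact hnbw)
    rw [mem_closedNbwPen]
    refine ⟨⟨?_, fun t ht => ?_⟩, hnbw'.1, hnbw'.2⟩
    · have h1 : pos (Fin.snoc (Fin.init η) s : StepSeq d (σ + 1)) (σ + 1) = stepVec s := by
        rw [hη', pos_eq_endpoint, hend]
      rw [pos_snoc_succ] at h1
      exact add_right_cancel (b := stepVec s) (by rw [h1, zero_add])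
    · rw [← pos_snoc_of_le (Fin.init η) s ht, hη']
      exact havoid t (by omega)
  · rintro ⟨ζ, hζ, rfl⟩
    rw [mem_closedNbwPen] at hζ
    obtain ⟨⟨hend, havoid⟩, hnbw, hlast⟩ := hζ
    have hend' : endpoint (Fin.snoc ζ s : StepSeq d (σ + 1)) = stepVec s := by
      rw [endpoint_snoc, hend, zero_add]
    refine ⟨⟨⟨(isNBW_snoc_iff ζ s).2 ⟨hnbw, hlast⟩, fun t ht => ?_⟩, hend'⟩, stepSeq_snoc_apply_eq ζ s rfl _⟩
    rcases Nat.lt_or_ge t (σ + 1) with hlt | hge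
    · rw [pos_snoc_of_le ζ s (show t ≤ σ by omega)]
      exact havoid t (by omega)
    · rw [pos_of_le _ hge, hend']
      exact hs

/-- **The bijections of (3.17), counted**: `#closedNbwLast A s (σ+2) + #closedNbwPen A s σ = #nbwAvoidTo A e_s (σ+1)`
for `0 ∉ A`, `e_s ∉ A`. [cite: HaraSladeSokal1993, §3.3 eq. (3.17) p. 19] -/
theorem card_closedNbwLast_add_two_add {A : Finset (Site d)} (h0 : (0 : Site d) ∉ A) {s : Dir d}
    (hs : stepVec s ∉ A) (σ : ℕ) :
    (closedNbwLast A s (σ + 2)).card + (closedNbwPen A s σ).card = (nbwAvoidTo A (stepVec s) (σ + 1)).card := by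
  classical
  have hinj2 : Function.Injective fun η : StepSeq d (σ + 1) => (Fin.snoc η (srev s) : StepSeq d (σ + 2)) :=
    fun η η' h => by simpa [Fin.init_snoc] using congrArg Fin.init h
  have hinj1 : Function.Injective fun ζ : StepSeq d σ => (Fin.snoc ζ s : StepSeq d (σ + 1)) :=
    fun ζ ζ' h => by simpa [Fin.init_snoc] using congrArg Fin.init h
  rw [closedNbwLast_add_two_eq_image h0 s σ, Finset.card_image_of_injective _ hinj2,
    ← Finset.card_image_of_injective (closedNbwPen A s σ) hinj1,
    ← filter_nbwAvoidTo_eq_image_closedNbwPen hs σ, add_comm]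
  exact Finset.card_filter_add_card_filter_not _

/-- **The linear recurrence ((3.16) + (3.17))**: `p̃_{σ+2} + q_{σ+1} = a_{σ+2} + p̃_σ` with `p̃ = #closedNbwPen A s`,
`q = #nbwAvoidTo A e_s`, `a = #nbwAvoidTo A 0` (`0 ∉ A`, `e_s ∉ A`).
[cite: HaraSladeSokal1993, §3.3 eq. (3.16)–(3.18) p. 19] -/
theorem card_closedNbwPen_add_two_add {A : Finset (Site d)} (h0 : (0 : Site d) ∉ A) {s : Dir d}
    (hs : stepVec s ∉ A) (σ : ℕ) :
    (closedNbwPen A s (σ + 2)).card + (nbwAvoidTo A (stepVec s) (σ + 1)).card =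
      (nbwAvoidTo A 0 (σ + 2)).card + (closedNbwPen A s σ).card := by
  have h1 := card_closedNbwPen_add_card_closedNbwLast A s (σ + 2)
  have h2 := card_closedNbwLast_add_two_add h0 hs σ
  omega

/-! ### Initial values -/

/-- No closed loop has length `1`: `#nbwAvoidTo A 0 1 = 0`. [cite: HaraSladeSokal1993, §3.3 eq. (3.16)–(3.18) p. 19 (lane plumbing: initial values of the recurrence)] -/
theorem nbwAvoidTo_zero_one (A : Finset (Site d)) : nbwAvoidTo A 0 1 = ∅ := by
  classical
  refine Finset.eq_empty_of_forall_notMem fun ω hω => ?_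
  rw [mem_nbwAvoidTo] at hω
  have h : endpoint ω = stepVec (ω 0) := by
    rw [endpoint, Fin.sum_univ_one]
  exact stepVec_ne_zero (ω 0) (h ▸ hω.2)

/-- `#closedNbwPen A s 1 = 0`. [cite: HaraSladeSokal1993, §3.3 eq. (3.16)–(3.18) p. 19 (lane plumbing: initial values of the recurrence)] -/
theorem card_closedNbwPen_one (A : Finset (Site d)) (s : Dir d) : (closedNbwPen A s 1).card = 0 := by
  have h := card_closedNbwPen_add_card_closedNbwLast A s 1
  rw [nbwAvoidTo_zero_one, Finset.card_empty] at h
  omega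

/-- `#nbwAvoidTo A 0 1 = 0` as a number. [cite: HaraSladeSokal1993, §3.3 eq. (3.16)–(3.18) p. 19 (lane plumbing: initial values of the recurrence)] -/
theorem card_nbwAvoidTo_zero_one (A : Finset (Site d)) : (nbwAvoidTo A 0 1).card = 0 := by
  rw [nbwAvoidTo_zero_one, Finset.card_empty]

/-- The empty walk does not reach `e_s`: `#nbwAvoidTo A e_s 0 = 0`. [cite: HaraSladeSokal1993, §3.3 eq. (3.16)–(3.18) p. 19 (lane plumbing: initial values of the recurrence)] -/
theorem card_nbwAvoidTo_stepVec_zero (A : Finset (Site d)) (s : Dir d) : (nbwAvoidTo A (stepVec s) 0).card = 0 := by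
  classical
  rw [Finset.card_eq_zero]
  refine Finset.eq_empty_of_forall_notMem fun ω hω => ?_
  rw [mem_nbwAvoidTo, endpoint_zero] at hω
  exact stepVec_ne_zero s hω.2.symm

/-- At length `0` there is no last step: `#closedNbwLast A s 0 = 0`, so `p̃₀ = a₀`. [cite: HaraSladeSokal1993, §3.3 eq. (3.16)–(3.18) p. 19 (lane plumbing: initial values of the recurrence)] -/
theorem card_closedNbwPen_zero_eq (A : Finset (Site d)) (s : Dir d) :
    (closedNbwPen A s 0).card = (nbwAvoidTo A 0 0).card := by
  classical
  have h := card_closedNbwPen_add_card_closedNbwLast A s 0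
  have h0 : closedNbwLast A s 0 = ∅ := by
    refine Finset.eq_empty_of_forall_notMem fun ω hω => ?_
    rw [mem_closedNbwLast] at hω
    obtain ⟨i, _, _⟩ := hω.2.2
    exact i.elim0
  rw [h0, Finset.card_empty] at h
  omega

/-! ### (3.18), multiplied out: truncated generating functions -/

/-- **(3.18) at every truncation order**: with `P_K = Σ_{σ≤K} p̃_σ βᵠ`, `Q_K = Σ_{σ≤K} q_σ βᵠ`, `A_K = Σ_{σ≤K} a_σ βᵠ`,
`P_{K+2} + β·Q_{K+1} = A_{K+2} + β²·P_K` (exactly; `(1 − β²)·C̃ = C^A₂(0,0) − β·C^A₂(0,e)` in the limit).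
[cite: HaraSladeSokal1993, §3.3 eq. (3.18) p. 19] -/
theorem sum_closedNbwPen_add_two_eq {A : Finset (Site d)} (h0 : (0 : Site d) ∉ A) {s : Dir d}
    (hs : stepVec s ∉ A) (β : ℝ) (K : ℕ) :
    ∑ σ ∈ range (K + 3), ((closedNbwPen A s σ).card : ℝ) * β ^ σ +
        β * ∑ σ ∈ range (K + 2), ((nbwAvoidTo A (stepVec s) σ).card : ℝ) * β ^ σ =
      ∑ σ ∈ range (K + 3), ((nbwAvoidTo A 0 σ).card : ℝ) * β ^ σ +
        β ^ 2 * ∑ σ ∈ range (K + 1), ((closedNbwPen A s σ).card : ℝ) * β ^ σ := by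
  induction K with
  | zero =>
    have e0 : ((closedNbwPen A s 0).card : ℝ) = (nbwAvoidTo A 0 0).card := by
      exact_mod_cast card_closedNbwPen_zero_eq A s
    have e1 := card_closedNbwPen_one A s
    have a1 := card_nbwAvoidTo_zero_one A
    have q0 := card_nbwAvoidTo_stepVec_zero A s
    have h' : ((closedNbwPen A s 2).card : ℝ) + (nbwAvoidTo A (stepVec s) 1).card =
        (nbwAvoidTo A 0 2).card + (closedNbwPen A s 0).card := by
      exact_mod_cast card_closedNbwPen_add_two_add h0 hs 0
    simp only [Finset.sum_range_succ, Finset.sum_range_zero, zero_add, pow_zero, mul_one, pow_one, e1, a1, q0,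
      Nat.cast_zero, zero_mul, add_zero]
    linear_combination e0 + β ^ 2 * h'
  | succ K ih =>
    have h' : ((closedNbwPen A s (K + 3)).card : ℝ) + (nbwAvoidTo A (stepVec s) (K + 2)).card =
        (nbwAvoidTo A 0 (K + 3)).card + (closedNbwPen A s (K + 1)).card := by
      exact_mod_cast card_closedNbwPen_add_two_add h0 hs (K + 1)
    rw [show K + 1 + 3 = (K + 3) + 1 from rfl, show K + 1 + 2 = (K + 2) + 1 from rfl,
      Finset.sum_range_succ (fun σ => ((closedNbwPen A s σ).card : ℝ) * β ^ σ) (K + 3),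
      Finset.sum_range_succ (fun σ => ((nbwAvoidTo A (stepVec s) σ).card : ℝ) * β ^ σ) (K + 2),
      Finset.sum_range_succ (fun σ => ((nbwAvoidTo A 0 σ).card : ℝ) * β ^ σ) (K + 3),
      Finset.sum_range_succ (fun σ => ((closedNbwPen A s σ).card : ℝ) * β ^ σ) (K + 1)]
    linear_combination ih + β ^ (K + 3) * h'

/-- The truncated penalised loop sums are monotone in the truncation. [cite: HaraSladeSokal1993, §3.3 eq. (3.18) p. 19 (lane plumbing)] -/
theorem sum_closedNbwPen_mono (A : Finset (Site d)) (s : Dir d) {β : ℝ} (hβ : 0 ≤ β) {K K' : ℕ} (h : K ≤ K') :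
    ∑ σ ∈ range (K + 1), ((closedNbwPen A s σ).card : ℝ) * β ^ σ ≤
      ∑ σ ∈ range (K' + 1), ((closedNbwPen A s σ).card : ℝ) * β ^ σ :=
  Finset.sum_le_sum_of_subset_of_nonneg (Finset.range_subset_range.2 (by omega))
    fun σ _ _ => mul_nonneg (Nat.cast_nonneg _) (pow_nonneg hβ σ)

/-- **(3.18) as an inequality at every truncation**: `(1 − β²)·P_{K+2} ≤ A_{K+2} − β·Q_{K+1}` for `β ≥ 0`.
[cite: HaraSladeSokal1993, §3.3 eq. (3.18) p. 19] -/
theorem one_sub_sq_mul_sum_closedNbwPen_le {A : Finset (Site d)} (h0 : (0 : Site d) ∉ A) {s : Dir d}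
    (hs : stepVec s ∉ A) {β : ℝ} (hβ : 0 ≤ β) (K : ℕ) :
    (1 - β ^ 2) * ∑ σ ∈ range (K + 3), ((closedNbwPen A s σ).card : ℝ) * β ^ σ ≤
      ∑ σ ∈ range (K + 3), ((nbwAvoidTo A 0 σ).card : ℝ) * β ^ σ -
        β * ∑ σ ∈ range (K + 2), ((nbwAvoidTo A (stepVec s) σ).card : ℝ) * β ^ σ := by
  have h := sum_closedNbwPen_add_two_eq h0 hs β K
  have hm := mul_le_mul_of_nonneg_left (sum_closedNbwPen_mono A s hβ (show K ≤ K + 2 by omega)) (sq_nonneg β)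
  linarith

/-- **The `W` of the memory-`2̃` bound from (3.18)**: if `A_K ≤ A⁺` for every `K` (an upper bound for
`C^A₂(0,0;β)`) and `0 ≤ β < 1`, then for every `K₀` (a truncation of `C^A₂(0,e_s;β)` from below) and every `K`,
`P_K ≤ (A⁺ − β·Q_{K₀})/(1 − β²)`. [cite: HaraSladeSokal1993, §3.3 eq. (3.18) p. 19 ("the bound (2.39) can be computed once we know C^A_2(0,0) and C^A_2(0,e)")] -/
theorem sum_closedNbwPen_le_div {A : Finset (Site d)} (h0 : (0 : Site d) ∉ A) {s : Dir d} (hs : stepVec s ∉ A)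
    {β Aub : ℝ} (hβ : 0 ≤ β) (hβ1 : β < 1)
    (hA : ∀ K, ∑ σ ∈ range (K + 1), ((nbwAvoidTo A 0 σ).card : ℝ) * β ^ σ ≤ Aub) (K₀ K : ℕ) :
    ∑ σ ∈ range (K + 1), ((closedNbwPen A s σ).card : ℝ) * β ^ σ ≤
      (Aub - β * ∑ σ ∈ range (K₀ + 1), ((nbwAvoidTo A (stepVec s) σ).card : ℝ) * β ^ σ) / (1 - β ^ 2) := by
  have h1 : 0 < 1 - β ^ 2 := by nlinarith
  rw [le_div_iff₀ h1, mul_comm]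
  set M := K + K₀ with hM
  have hPK := sum_closedNbwPen_mono A s hβ (show K ≤ M + 2 by omega)
  have hmain := one_sub_sq_mul_sum_closedNbwPen_le h0 hs hβ M
  have hAM := hA (M + 2)
  have hQ : ∑ σ ∈ range (K₀ + 1), ((nbwAvoidTo A (stepVec s) σ).card : ℝ) * β ^ σ ≤
      ∑ σ ∈ range (M + 2), ((nbwAvoidTo A (stepVec s) σ).card : ℝ) * β ^ σ :=
    Finset.sum_le_sum_of_subset_of_nonneg (Finset.range_subset_range.2 (by omega))
      fun σ _ _ => mul_nonneg (Nat.cast_nonneg _) (pow_nonneg hβ σ)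
  have hβQ := mul_le_mul_of_nonneg_left hQ hβ
  calc (1 - β ^ 2) * ∑ σ ∈ range (K + 1), ((closedNbwPen A s σ).card : ℝ) * β ^ σ
      ≤ (1 - β ^ 2) * ∑ σ ∈ range (M + 3), ((closedNbwPen A s σ).card : ℝ) * β ^ σ :=
        mul_le_mul_of_nonneg_left hPK h1.le
    _ ≤ _ := by linarith

end Literature.Probability.RandomPlanarGeometry.SAW.Zd.LoopErasure

end
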